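import Mathlib
import Summits.ValiantsHypothesis.ValiantsHypothesis.Theorems.NewtonUnitEquationsNewtonTauWeakCornerDefs
import Summits.ValiantsHypothesis.ValiantsHypothesis.Theorems.NewtonUnitEquationsNewtonTauWeakCornerWords

/-!
# `NewtonTauWeak` (stmt-ValiantsHypothesis-5904), sub-stub `fixedKCoincidence_t2_K3` (siege k15):
# the Laurent ring `ℂ[ℤ²]` and separated products

First file of the siege line `K3R15` ("linear-algebra rank route", attempt 15) towards the registered
sub-stub `fixedKCoincidence_t2_K3` of `stub_binomialNewtonTauCommon` (KPTT arXiv:1308.2286 Conj. 1 at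
`t = 2`, `K = 3` products, exponent lists without short 2-vs-1 relations).

After the flip identity (file `…K3R15Flip`) every product of binomials becomes, inside the Laurent ring
`ℂ[ℤ²] = AddMonoidAlgebra ℂ (Fin 2 → ℤ)`, a monomial times a SEPARATED PRODUCT
`Π_e P_e(T^{E_e})` of univariate polynomials evaluated at the monomials of pairwise non-parallel
directions `E_e ∈ ℤ²` — exactly the word model of `…CornerDefs.lean` (`push`, `sepCoeff`, `box`,
`fibreSum`).  This file provides the dictionary:

* `coeff_single_mul'`, `coeff_smul'`, `wt_sub'` — coefficients of monomial multiples, weights;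
* `sepProd_eq_sum` — `Π_e aeval (T^{E_e}) P_e = Σ_{n ∈ box} T^{push n} · sepCoeff P n`, hence
  `coeff_sepProd` (coefficients are fibre sums of the separated coefficient) and `exists_word_of_coeff_sepProd_ne_zero`;
* `sepProd_mul` — separated products multiply factorwise;
* weights: `wt_push_nonneg`, `push_eq_zero_of_wt_le`, `coeff_sepProd_zero`, `wt_nonneg_of_mem_support_sepProd`;
* `coeff_mul_eq_zero_of_lt`, `coeff_mul_eq_of_init` — multiplying by a factor `1 + (positive weights)` does not
  move the `w`-initial term ("division by a unit" without power series);
* `coeff_add_heavy` — adding a HEAVY element (all weights `≥ Λ`) does not change coefficients below `Λ`;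
* `heavy_mul_nonneg`, `sepProd_sub_heavy` — products with heavy factors stay heavy, and
  `Π_e (a_e - h_e) = Π_e a_e + heavy` for nonnegative `a_e` and heavy `h_e`;
* `support_aeval_single`, `heavy_aeval_of_coeff_eq_zero` — supports of `aeval (T^{E}) Q`.

No definitions; everything is [folklore].
-/

-- the namespace mandated for this Theorems file repeats the component `ValiantsHypothesis`
set_option linter.dupNamespace false

noncomputable section

open scoped BigOperators Polynomial
open AddMonoidAlgebra
open Summit.ValiantsHypothesis.ValiantsHypothesis.Theorems.NewtonTauWeakCorner

namespace Summit.ValiantsHypothesis.ValiantsHypothesis.Theorems.NewtonTauWeakK3R15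

/-! ## Coefficients of monomial multiples; weights -/

/-- Coefficient of `c·T^u · X` at `z` is `c · [T^{z-u}] X`. [folklore] -/
theorem coeff_single_mul' (u z : Fin 2 → ℤ) (c : ℂ) (X : AddMonoidAlgebra ℂ (Fin 2 → ℤ)) :
    (single u c * X).coeff z = c * X.coeff (z - u) := by
  refine coeff_single_mul_eq_mul_coeff (z - u) (fun m' _ => ?_)
  constructor
  · intro h; rw [← h]; abel
  · intro h; rw [h]; abel

/-- Coefficient of a scalar multiple. [folklore] -/
theorem coeff_smul' (c : ℂ) (X : AddMonoidAlgebra ℂ (Fin 2 → ℤ)) (z : Fin 2 → ℤ) :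
    (c • X).coeff z = c * X.coeff z := by
  rw [coeff_smul_apply, smul_eq_mul]

/-- Weight of a difference. [folklore] -/
theorem wt_sub' (w : Fin 2 → ℝ) (z z' : Fin 2 → ℤ) : wt w (z - z') = wt w z - wt w z' := by
  simp only [wt, Pi.sub_apply, Int.cast_sub]; ring

/-- Weight of a negative. [folklore] -/
theorem wt_neg' (w : Fin 2 → ℝ) (z : Fin 2 → ℤ) : wt w (-z) = -wt w z := by
  simp only [wt, Pi.neg_apply, Int.cast_neg]; ring

/-- Weight of a natural multiple. [folklore] -/
theorem wt_natsmul' (w : Fin 2 → ℝ) (k : ℕ) (z : Fin 2 → ℤ) : wt w ((k : ℤ) • z) = (k : ℝ) * wt w z := by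
  rw [wt_zsmul]; push_cast; ring

/-! ## Separated products: expansion over the word box -/

/-- **Expansion of a separated product.** `Π_e P_e(T^{E_e}) = Σ_{n ∈ box s D} sepCoeff P n · T^{push E n}`
when all degrees are `≤ D`. [folklore] -/
theorem sepProd_eq_sum {s D : ℕ} (E : Fin s → Fin 2 → ℤ) (P : Fin s → ℂ[X]) (hD : ∀ e, (P e).natDegree ≤ D) :
    (∏ e, Polynomial.aeval (single (E e) (1 : ℂ) : AddMonoidAlgebra ℂ (Fin 2 → ℤ)) (P e)) =
      ∑ n ∈ box s D, single (push E n) (sepCoeff P n) := by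
  classical
  have h1 : ∀ e, Polynomial.aeval (single (E e) (1 : ℂ) : AddMonoidAlgebra ℂ (Fin 2 → ℤ)) (P e) =
      ∑ i ∈ Finset.range (D + 1), single ((i : ℤ) • E e) ((P e).coeff i) := by
    intro e
    rw [Polynomial.aeval_eq_sum_range' (Nat.lt_succ_of_le (hD e))]
    refine Finset.sum_congr rfl fun i _ => ?_
    rw [single_pow, one_pow, smul_single', mul_one, natCast_zsmul]
  simp_rw [h1]
  rw [Finset.prod_univ_sum]
  refine Finset.sum_congr rfl fun n _ => ?_
  rw [prod_single]
  rfl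

/-- **Coefficients of a separated product are fibre sums** of the separated coefficient over the box.
[folklore] -/
theorem coeff_sepProd {s D : ℕ} (E : Fin s → Fin 2 → ℤ) (P : Fin s → ℂ[X]) (hD : ∀ e, (P e).natDegree ≤ D)
    (z : Fin 2 → ℤ) :
    (∏ e, Polynomial.aeval (single (E e) (1 : ℂ) : AddMonoidAlgebra ℂ (Fin 2 → ℤ)) (P e)).coeff z =
      ∑ n ∈ (box s D).filter (fun n => push E n = z), sepCoeff P n := by
  classical
  rw [sepProd_eq_sum E P hD, coeff_sum, Finset.sum_apply', Finset.sum_filter]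
  refine Finset.sum_congr rfl fun n _ => ?_
  rw [coeff_single, Finsupp.single_apply]

/-- A nonzero coefficient of a separated product comes from a word of the box with nonzero separated
coefficient. [folklore] -/
theorem exists_word_of_coeff_sepProd_ne_zero {s D : ℕ} (E : Fin s → Fin 2 → ℤ) (P : Fin s → ℂ[X])
    (hD : ∀ e, (P e).natDegree ≤ D) {z : Fin 2 → ℤ}
    (hz : (∏ e, Polynomial.aeval (single (E e) (1 : ℂ) : AddMonoidAlgebra ℂ (Fin 2 → ℤ)) (P e)).coeff z ≠ 0) :
    ∃ n ∈ box s D, push E n = z ∧ sepCoeff P n ≠ 0 := by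
  classical
  rw [coeff_sepProd E P hD] at hz
  obtain ⟨n, hn, hne⟩ := Finset.exists_ne_zero_of_sum_ne_zero hz
  exact ⟨n, (Finset.mem_filter.mp hn).1, (Finset.mem_filter.mp hn).2, hne⟩

/-- Separated products multiply factorwise. [folklore] -/
theorem sepProd_mul {s : ℕ} (E : Fin s → Fin 2 → ℤ) (P Q : Fin s → ℂ[X]) :
    (∏ e, Polynomial.aeval (single (E e) (1 : ℂ) : AddMonoidAlgebra ℂ (Fin 2 → ℤ)) (P e)) *
      (∏ e, Polynomial.aeval (single (E e) (1 : ℂ) : AddMonoidAlgebra ℂ (Fin 2 → ℤ)) (Q e)) =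
      ∏ e, Polynomial.aeval (single (E e) (1 : ℂ) : AddMonoidAlgebra ℂ (Fin 2 → ℤ)) (P e * Q e) := by
  rw [← Finset.prod_mul_distrib]
  refine Finset.prod_congr rfl fun e _ => ?_
  rw [map_mul]

/-! ## Weights of pushed words -/

/-- With positive direction weights, pushed words have nonnegative weight. [folklore] -/
theorem wt_push_nonneg {s : ℕ} (E : Fin s → Fin 2 → ℤ) (w : Fin 2 → ℝ) (hw : ∀ e, 0 < wt w (E e))
    (n : Fin s → ℕ) : 0 ≤ wt w (push E n) := by
  rw [wt_push]
  exact Finset.sum_nonneg fun e _ => mul_nonneg (Nat.cast_nonneg _) (hw e).le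

/-- With positive direction weights, only the empty word has weight `≤ 0`. [folklore] -/
theorem push_eq_zero_of_wt_le {s : ℕ} (E : Fin s → Fin 2 → ℤ) (w : Fin 2 → ℝ) (hw : ∀ e, 0 < wt w (E e))
    (n : Fin s → ℕ) (h : wt w (push E n) ≤ 0) : n = 0 := by
  rw [wt_push] at h
  have hnn : ∀ e ∈ (Finset.univ : Finset (Fin s)), 0 ≤ (n e : ℝ) * wt w (E e) :=
    fun e _ => mul_nonneg (Nat.cast_nonneg _) (hw e).le
  have h0 : ∑ e, (n e : ℝ) * wt w (E e) = 0 := le_antisymm h (Finset.sum_nonneg hnn)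
  have hall := (Finset.sum_eq_zero_iff_of_nonneg hnn).mp h0
  funext e
  have := hall e (Finset.mem_univ e)
  rcases mul_eq_zero.mp this with h1 | h1
  · exact_mod_cast h1
  · exact absurd h1 (hw e).ne'

/-- Support points of a separated product have nonnegative weight. [folklore] -/
theorem wt_nonneg_of_coeff_sepProd_ne_zero {s : ℕ} (E : Fin s → Fin 2 → ℤ) (w : Fin 2 → ℝ)
    (hw : ∀ e, 0 < wt w (E e)) (P : Fin s → ℂ[X]) {z : Fin 2 → ℤ}
    (hz : (∏ e, Polynomial.aeval (single (E e) (1 : ℂ) : AddMonoidAlgebra ℂ (Fin 2 → ℤ)) (P e)).coeff z ≠ 0) :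
    0 ≤ wt w z := by
  obtain ⟨n, -, hpush, -⟩ := exists_word_of_coeff_sepProd_ne_zero E P (fun e => le_rfl.trans
    (Finset.le_sup (f := fun e => (P e).natDegree) (Finset.mem_univ e))) hz
  rw [← hpush]
  exact wt_push_nonneg E w hw n

/-- A support point of weight `≤ 0` of a separated product is the origin. [folklore] -/
theorem eq_zero_of_coeff_sepProd_ne_zero_of_wt_le {s : ℕ} (E : Fin s → Fin 2 → ℤ) (w : Fin 2 → ℝ)
    (hw : ∀ e, 0 < wt w (E e)) (P : Fin s → ℂ[X]) {z : Fin 2 → ℤ}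
    (hz : (∏ e, Polynomial.aeval (single (E e) (1 : ℂ) : AddMonoidAlgebra ℂ (Fin 2 → ℤ)) (P e)).coeff z ≠ 0)
    (hle : wt w z ≤ 0) : z = 0 := by
  obtain ⟨n, -, hpush, -⟩ := exists_word_of_coeff_sepProd_ne_zero E P (fun e => le_rfl.trans
    (Finset.le_sup (f := fun e => (P e).natDegree) (Finset.mem_univ e))) hz
  rw [← hpush] at hle ⊢
  rw [push_eq_zero_of_wt_le E w hw n hle, push_zero]

/-- The constant coefficient of a separated product is the product of the constant coefficients
(positive direction weights). [folklore] -/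
theorem coeff_sepProd_zero {s : ℕ} (E : Fin s → Fin 2 → ℤ) (w : Fin 2 → ℝ) (hw : ∀ e, 0 < wt w (E e))
    (P : Fin s → ℂ[X]) :
    (∏ e, Polynomial.aeval (single (E e) (1 : ℂ) : AddMonoidAlgebra ℂ (Fin 2 → ℤ)) (P e)).coeff 0 =
      ∏ e, (P e).coeff 0 := by
  classical
  set D := Finset.univ.sup fun e => (P e).natDegree with hDdef
  have hD : ∀ e, (P e).natDegree ≤ D := fun e => Finset.le_sup (f := fun e => (P e).natDegree) (Finset.mem_univ e)
  rw [coeff_sepProd E P hD, Finset.sum_eq_single_of_mem (0 : Fin s → ℕ)]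
  · rfl
  · refine Finset.mem_filter.mpr ⟨?_, push_zero E⟩
    simp [box]
  · intro n hn hne
    exfalso
    have hpush := (Finset.mem_filter.mp hn).2
    have := push_eq_zero_of_wt_le E w hw n (by rw [hpush, wt_zero])
    exact hne this

/-! ## Initial terms under multiplication by units and heavy perturbations -/

/-- If every support point of `X` weighs at least `wt v` and every support point of `B` has positive
weight, then `X * B` has no coefficient of weight `≤ wt v`. [folklore] -/
theorem coeff_mul_eq_zero_of_lt (w : Fin 2 → ℝ) (X B : AddMonoidAlgebra ℂ (Fin 2 → ℤ)) (v : Fin 2 → ℤ)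
    (hX : ∀ a ∈ X.coeff.support, wt w v ≤ wt w a) (hB : ∀ b ∈ B.coeff.support, 0 < wt w b)
    (z : Fin 2 → ℤ) (hz : wt w z ≤ wt w v) : (X * B).coeff z = 0 := by
  classical
  rw [coeff_mul]
  refine Finset.sum_eq_zero (fun a ha => Finset.sum_eq_zero (fun b hb => ?_))
  show (if a + b = z then X.coeff a * B.coeff b else 0) = 0
  rw [if_neg]
  intro hab
  have h1 := hX a ha
  have h2 := hB b hb
  have : wt w z = wt w a + wt w b := by rw [← hab, wt_add]
  linarith

/-- **Division-free unit lemma.** If `A = 1 + B` with `B` of positive weights, and `v` is the `w`-initial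
support point of `X` (all lighter coefficients vanish), then `X * A` has the same coefficient at `v` and
still vanishes below `v`. [folklore] -/
theorem coeff_mul_eq_of_init (w : Fin 2 → ℝ) (X A : AddMonoidAlgebra ℂ (Fin 2 → ℤ))
    (hA0 : A.coeff 0 = 1) (hApos : ∀ b ∈ A.coeff.support, b ≠ 0 → 0 < wt w b)
    (v : Fin 2 → ℤ) (hcanc : ∀ z, wt w z < wt w v → X.coeff z = 0) :
    (X * A).coeff v = X.coeff v ∧ ∀ z, wt w z < wt w v → (X * A).coeff z = 0 := by
  classical
  set B : AddMonoidAlgebra ℂ (Fin 2 → ℤ) := A - single 0 1 with hBdef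
  have hA : A = single 0 1 + B := by rw [hBdef]; abel
  have hB : ∀ b ∈ B.coeff.support, 0 < wt w b := by
    intro b hb
    have hb' : B.coeff b ≠ 0 := Finsupp.mem_support_iff.mp hb
    have hb0 : b ≠ 0 := by
      rintro rfl
      apply hb'
      rw [hBdef, coeff_sub, Finsupp.sub_apply, hA0, coeff_single, Finsupp.single_apply, if_pos rfl, sub_self]
    have hbA : b ∈ A.coeff.support := by
      rw [Finsupp.mem_support_iff]
      intro h0
      apply hb'
      rw [hBdef, coeff_sub, Finsupp.sub_apply, h0, coeff_single, Finsupp.single_apply, if_neg (Ne.symm hb0),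
        sub_zero]
    exact hApos b hbA hb0
  have hX : ∀ a ∈ X.coeff.support, wt w v ≤ wt w a := by
    intro a ha
    by_contra hlt
    push Not at hlt
    exact (Finsupp.mem_support_iff.mp ha) (hcanc a hlt)
  have hXB := coeff_mul_eq_zero_of_lt w X B v hX hB
  have hsplit : X * A = X + X * B := by rw [hA, mul_add, ← one_def, mul_one]
  refine ⟨?_, fun z hz => ?_⟩
  · rw [hsplit, coeff_add, Finsupp.add_apply, hXB v le_rfl, add_zero]
  · rw [hsplit, coeff_add, Finsupp.add_apply, hXB z hz.le, hcanc z hz, add_zero]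

/-- Adding a HEAVY element (all support weights `≥ Λ`) does not change coefficients of weight `< Λ`.
[folklore] -/
theorem coeff_add_heavy (w : Fin 2 → ℝ) (Λ : ℝ) (Y H : AddMonoidAlgebra ℂ (Fin 2 → ℤ))
    (hH : ∀ b ∈ H.coeff.support, Λ ≤ wt w b) (z : Fin 2 → ℤ) (hz : wt w z < Λ) :
    (Y + H).coeff z = Y.coeff z := by
  rw [coeff_add, Finsupp.add_apply]
  have : H.coeff z = 0 := by
    by_contra hne
    have := hH z (Finsupp.mem_support_iff.mpr hne)
    linarith
  rw [this, add_zero]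

/-- Heavy times nonnegative is heavy. [folklore] -/
theorem heavy_mul_nonneg (w : Fin 2 → ℝ) (Λ : ℝ) (H Y : AddMonoidAlgebra ℂ (Fin 2 → ℤ))
    (hH : ∀ b ∈ H.coeff.support, Λ ≤ wt w b) (hY : ∀ b ∈ Y.coeff.support, 0 ≤ wt w b) :
    ∀ b ∈ (H * Y).coeff.support, Λ ≤ wt w b := by
  classical
  intro b hb
  obtain ⟨a, ha, c, hc, rfl⟩ := Finset.mem_add.mp (support_coeff_mul_subset H Y hb)
  rw [wt_add]
  linarith [hH a ha, hY c hc]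

/-- Nonnegative times heavy is heavy. [folklore] -/
theorem nonneg_mul_heavy (w : Fin 2 → ℝ) (Λ : ℝ) (Y H : AddMonoidAlgebra ℂ (Fin 2 → ℤ))
    (hY : ∀ b ∈ Y.coeff.support, 0 ≤ wt w b) (hH : ∀ b ∈ H.coeff.support, Λ ≤ wt w b) :
    ∀ b ∈ (Y * H).coeff.support, Λ ≤ wt w b := by
  classical
  intro b hb
  obtain ⟨a, ha, c, hc, rfl⟩ := Finset.mem_add.mp (support_coeff_mul_subset Y H hb)
  rw [wt_add]
  linarith [hY a ha, hH c hc]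

/-- Sums and differences of heavy elements are heavy. [folklore] -/
theorem heavy_sub (w : Fin 2 → ℝ) (Λ : ℝ) (H H' : AddMonoidAlgebra ℂ (Fin 2 → ℤ))
    (hH : ∀ b ∈ H.coeff.support, Λ ≤ wt w b) (hH' : ∀ b ∈ H'.coeff.support, Λ ≤ wt w b) :
    ∀ b ∈ (H - H').coeff.support, Λ ≤ wt w b := by
  intro b hb
  rw [coeff_sub] at hb
  rcases Finset.mem_union.mp (Finsupp.support_sub hb) with h | h
  · exact hH b h
  · exact hH' b h

/-- Products of nonnegative elements are nonnegative. [folklore] -/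
theorem nonneg_mul (w : Fin 2 → ℝ) (Y Y' : AddMonoidAlgebra ℂ (Fin 2 → ℤ))
    (hY : ∀ b ∈ Y.coeff.support, 0 ≤ wt w b) (hY' : ∀ b ∈ Y'.coeff.support, 0 ≤ wt w b) :
    ∀ b ∈ (Y * Y').coeff.support, 0 ≤ wt w b := by
  simpa using heavy_mul_nonneg w 0 Y Y' hY hY'

/-- **`Π_e (a_e - h_e) = Π_e a_e + heavy`** for nonnegative `a_e` and heavy `h_e` (`Λ ≥ 0`). [folklore] -/
theorem sepProd_sub_heavy (w : Fin 2 → ℝ) (Λ : ℝ) (hΛ : 0 ≤ Λ) {ι : Type*} (t : Finset ι)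
    (a h : ι → AddMonoidAlgebra ℂ (Fin 2 → ℤ))
    (ha : ∀ i ∈ t, ∀ b ∈ (a i).coeff.support, 0 ≤ wt w b)
    (hh : ∀ i ∈ t, ∀ b ∈ (h i).coeff.support, Λ ≤ wt w b) :
    (∀ b ∈ (∏ i ∈ t, (a i - h i) - ∏ i ∈ t, a i).coeff.support, Λ ≤ wt w b) ∧
      (∀ b ∈ (∏ i ∈ t, a i).coeff.support, 0 ≤ wt w b) := by
  classical
  induction t using Finset.induction_on with
  | empty =>
    constructor
    · intro b hb; simp at hb
    · intro b hb
      rw [Finset.prod_empty, one_def, coeff_single] at hb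
      have := Finset.mem_of_subset Finsupp.support_single_subset hb
      rw [Finset.mem_singleton] at this
      rw [this, wt_zero]
  | insert i t hi ih =>
    obtain ⟨ih1, ih2⟩ := ih (fun j hj => ha j (Finset.mem_insert_of_mem hj)) (fun j hj => hh j (Finset.mem_insert_of_mem hj))
    have hai := ha i (Finset.mem_insert_self i t)
    have hhi := hh i (Finset.mem_insert_self i t)
    rw [Finset.prod_insert hi, Finset.prod_insert hi]
    set A := ∏ j ∈ t, a j with hA
    set G := ∏ j ∈ t, (a j - h j) - A with hG
    have hprod : ∏ j ∈ t, (a j - h j) = A + G := by rw [hG]; abel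
    constructor
    · have hexp : (a i - h i) * (A + G) - a i * A = a i * G - h i * A - h i * G := by ring
      rw [hprod, hexp]
      refine heavy_sub w Λ _ _ (heavy_sub w Λ _ _ ?_ ?_) ?_
      · exact nonneg_mul_heavy w Λ _ _ hai ih1
      · exact heavy_mul_nonneg w Λ _ _ hhi ih2
      · exact heavy_mul_nonneg w Λ _ _ hhi (fun b hb => hΛ.trans (ih1 b hb))
    · exact nonneg_mul w _ _ hai ih2

/-! ## Supports of evaluated univariate polynomials -/

/-- `aeval (T^{v}) Q` is supported on the multiples `i·v`, `i ≤ natDegree Q`, with `[T^{iv}] = Q_i`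
whenever `i ↦ i·v` is injective (e.g. `wt v ≠ 0`). Weak form: every support point is some `i·v` with
`Q_i ≠ 0`. [folklore] -/
theorem support_aeval_single (v : Fin 2 → ℤ) (Q : ℂ[X]) {z : Fin 2 → ℤ}
    (hz : (Polynomial.aeval (single v (1 : ℂ) : AddMonoidAlgebra ℂ (Fin 2 → ℤ)) Q).coeff z ≠ 0) :
    ∃ i : ℕ, i ≤ Q.natDegree ∧ Q.coeff i ≠ 0 ∧ z = (i : ℤ) • v := by
  classical
  rw [Polynomial.aeval_eq_sum_range' (Nat.lt_succ_self _), coeff_sum, Finset.sum_apply'] at hz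
  obtain ⟨i, hi, hne⟩ := Finset.exists_ne_zero_of_sum_ne_zero hz
  rw [single_pow, one_pow, smul_single', mul_one, coeff_single, Finsupp.single_apply] at hne
  split_ifs at hne with h
  · exact ⟨i, Nat.lt_succ_iff.mp (Finset.mem_range.mp hi), hne, by rw [← h, natCast_zsmul]⟩
  · exact absurd rfl hne

/-- Support points of `aeval (T^v) Q` have nonnegative weight when `wt v > 0`. [folklore] -/
theorem wt_nonneg_aeval_single (w : Fin 2 → ℝ) (v : Fin 2 → ℤ) (hv : 0 < wt w v) (Q : ℂ[X]) :
    ∀ b ∈ (Polynomial.aeval (single v (1 : ℂ) : AddMonoidAlgebra ℂ (Fin 2 → ℤ)) Q).coeff.support,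
      0 ≤ wt w b := by
  intro b hb
  obtain ⟨i, -, -, rfl⟩ := support_aeval_single v Q (Finsupp.mem_support_iff.mp hb)
  rw [wt_natsmul']
  exact mul_nonneg (Nat.cast_nonneg _) hv.le

/-- If `Q` has no coefficients below `M`, then `aeval (T^v) Q` is heavy: weights `≥ M · wt v`. [folklore] -/
theorem heavy_aeval_of_coeff_eq_zero (w : Fin 2 → ℝ) (v : Fin 2 → ℤ) (hv : 0 < wt w v) (Q : ℂ[X]) (M : ℕ)
    (hQ : ∀ i, i < M → Q.coeff i = 0) :
    ∀ b ∈ (Polynomial.aeval (single v (1 : ℂ) : AddMonoidAlgebra ℂ (Fin 2 → ℤ)) Q).coeff.support,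
      (M : ℝ) * wt w v ≤ wt w b := by
  intro b hb
  obtain ⟨i, -, hi, rfl⟩ := support_aeval_single v Q (Finsupp.mem_support_iff.mp hb)
  have hMi : M ≤ i := by
    by_contra hlt
    push Not at hlt
    exact hi (hQ i hlt)
  rw [wt_natsmul']
  exact mul_le_mul_of_nonneg_right (by exact_mod_cast hMi) hv.le

/-- Powers of a polynomial without constant term have no coefficients below the exponent. [folklore] -/
theorem coeff_pow_eq_zero_of_lt (R : ℂ[X]) (hR : R.coeff 0 = 0) (M i : ℕ) (hi : i < M) : (R ^ M).coeff i = 0 := by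
  have hX : Polynomial.X ∣ R := Polynomial.X_dvd_iff.mpr hR
  obtain ⟨S, hS⟩ := pow_dvd_pow_of_dvd hX M
  rw [hS, Polynomial.coeff_X_pow_mul']
  rw [if_neg (by omega)]

end Summit.ValiantsHypothesis.ValiantsHypothesis.Theorems.NewtonTauWeakK3R15

end
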